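import Summits.AtomisticToContinuum.FouriersLaw.Theses.BoundaryEscapeDeficit

/-!
# `BoundaryEscapeDeficit.SumRule` from `BoundaryEscapeDeficit.HalfChainTailLaw`

Item `stmt-AtomisticToContinuum-12241` (support `SumRule`, route `BoundaryEscapeDeficit`, sub-problem
`FouriersLaw`) is filed as a "milestone ⊂ HalfChainTailLaw-upper": this file records that containment as a
theorem. If, for every `t ≥ t₀`, eventually in the length `M`,
`c/√t ≤ 1 − θ_M(t) ≤ C/√t` with `c > 0` (`HalfChainTailLaw`, item stmt-AtomisticToContinuum-12235), then for
every `ε > 0` and every `t ≥ max t₀ (C/ε)²`, eventually in `M`, `|1 − θ_M(t)| ≤ ε` (`SumRule`): the lower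
tail bound gives `1 − θ_M(t) ≥ 0` and the upper one gives `1 − θ_M(t) ≤ C/√t ≤ ε`.

This is pure bookkeeping on the two route declarations (the `let`-bound `P`, `K`, `θ` are syntactically
identical in both and are zeta-reduced by `dsimp only`); no property of the chain is used. The
unconditional `SumRule` — complete boundary thermalisation of the half-infinite pinned anharmonic chain,
i.e. absence of a ballistic channel — is an open problem (no theorem in print; false for the harmonic
chain, Rieder–Lebowitz–Lieb 1967), so this conditional form is what can be landed now.
-/

namespace Summit.AtomisticToContinuum.FouriersLaw.Theorems

open Summit.AtomisticToContinuum.FouriersLaw.Theses.BoundaryEscapeDeficit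

/-- **`SumRule` is a corollary of `HalfChainTailLaw`.** If `c/√t ≤ 1 − θ_M(t) ≤ C/√t` holds for all
`t ≥ t₀` eventually in `M` (with `c, t₀ > 0`), then for every `ε > 0`, all `t ≥ max t₀ (C/ε)²` and
eventually in `M`, `|1 − θ_M(t)| ≤ ε`. [folklore] -/
theorem sumRule_of_halfChainTailLaw (hTail : HalfChainTailLaw) : SumRule := by
  intro ω₂ lam β γ hω hl hβ hγ T hT
  have h := hTail ω₂ lam β γ hω hl hβ hγ T hT
  dsimp only at h ⊢
  obtain ⟨c, C, t₀, hc, ht₀, hTail'⟩ := h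
  intro ε hε
  refine ⟨max t₀ ((C / ε) ^ 2), fun t ht => ?_⟩
  have ht₀t : t₀ ≤ t := le_trans (le_max_left _ _) ht
  have hCt : (C / ε) ^ 2 ≤ t := le_trans (le_max_right _ _) ht
  have hpos : 0 < t := lt_of_lt_of_le ht₀ ht₀t
  have hsqrt : 0 < Real.sqrt t := Real.sqrt_pos.2 hpos
  -- `C ≤ ε √t`: from `(C/ε)² ≤ t` we get `|C/ε| ≤ √t`.
  have hCε : C ≤ ε * Real.sqrt t := by
    have h1 : |C / ε| ≤ Real.sqrt t := by
      rw [← Real.sqrt_sq_eq_abs]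
      exact Real.sqrt_le_sqrt hCt
    have h2 : C / ε ≤ Real.sqrt t := le_trans (le_abs_self _) h1
    have h3 : C = (C / ε) * ε := by field_simp
    rw [h3]
    nlinarith
  filter_upwards [hTail' t ht₀t] with M hM
  obtain ⟨hlow, hup⟩ := hM
  have hlow' : 0 < c / Real.sqrt t := div_pos hc hsqrt
  have hup' : C / Real.sqrt t ≤ ε := by
    rw [div_le_iff₀ hsqrt]
    exact hCε
  rw [abs_le]
  constructor
  · linarith
  · linarith

end Summit.AtomisticToContinuum.FouriersLaw.Theorems
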